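import Summits.QuantumFields.YangMills.Theses.FemtoCutoffLadder
import Summits.QuantumFields.YangMills.Theorems.FemtoCutoffLadderLocalWallReductions
import Summits.QuantumFields.YangMills.Theorems.FemtoCutoffLadderLargeFieldInsensitivityCompression

/-!
# Route `FemtoCutoffLadder`, crux `LocalWallStep` (stmt-QuantumFields-26282, skeleton «comparisons»):
# the monotone halves of the one-wall comparisons are free — the stub is EXACTLY two one-wall LOWER bounds

Seat `leafhand-qf-femtocutoffladder-2` g0 (2026-08-30), `--supports stmt-QuantumFields-26282`.  Rung R2b1 is a RECORD-label femto
gap — not infinite volume, not a mass gap, not Clay; no summit is proved by this file.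

The registered stub `stub_localWallComparisons` asks, for every wall set `Q` and `p₀ ∉ Q` (write `Q' = Q ∪ {p₀}`, `t = t Q`,
`t' = t Q'`, `s = s Q`, `s' = s Q'`, `a = A/(β²N)`, `N = #Plaquette 3 L`), for the two cross-multiplied comparisons
`s'^L t^L ≤ eᵃ s^L t'^L` and `s^L t'^L ≤ eᵃ s'^L t^L`.  Adding a wall STRENGTHENS the support constraint, so — on every lattice, for
every `β ≥ 0`, every real `κ`, with no window — `t' ≤ t` (`walledTop_anti`) and `s' ≤ s` (`walledSecond_anti`, from the general
`compressedSecond_mono`); all four values are `≥ 0`.  Hence (§3, ★ `localWallStep_of_oneWallLowerBounds`) the crux `LocalWallStep`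
follows BY NAME from the two ONE-SIDED per-time-step lower bounds
  `t Q ≤ e^{a/L} · t (Q ∪ {p₀})`  and  `s Q ≤ e^{a/L} · s (Q ∪ {p₀})`,
i.e. «walling off the κ-bad region of ONE more plaquette lowers neither the walled top Rayleigh value nor the walled first-excited
min–max value by more than the factor `e^{−A/(β²NL)}`» — the load-bearing content of the stub, isolated (§2 is the real-number endgame
`x' ≤ x, y ≤ e^{a/L} y' ⟹ x'^L y^L ≤ eᵃ x^L y'^L`).  ★ `localWallStep_of_oneWallPowLowerBounds` is the same door with the bounds
already raised to the `L`-th power (`t^L ≤ eᵃ t'^L`, `s^L ≤ eᵃ s'^L`).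
HONEST FRAMING: order bookkeeping only; the two lower bounds (one-defect relative spectral perturbation of the walled femto doublet,
uniform in the wall set) are OPEN and untouched.  No definitions, no named facts, no `sorry`.
[cite: ReedSimonIV1978, Thm. XIII.1]
-/

set_option autoImplicit false

noncomputable section

open MeasureTheory Filter Topology Real
open Literature.MathematicalPhysics.QuantumFieldTheory hiding SU2
open Literature.MathematicalPhysics.QuantumLattice

namespace Summit.QuantumFields.YangMills.Theorems.FemtoTransferGap.SFCompression

variable {L : ℕ} [NeZero L]

/-! ## §1 Monotonicity of compressed values in the constraint; the wall-set instances -/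

/-- **Monotonicity of compressed second values**: a stronger support constraint gives a smaller min–max second value
(junk values included; `β ≥ 0`). [cite: ReedSimonIV1978, Thm. XIII.1] -/
theorem compressedSecond_mono {β : ℝ} (hβ : 0 ≤ β) {P Q : (GaugeConfig 3 L SU2 → ℝ) → Prop} (h : ∀ ψ, P ψ → Q ψ) :
    sInf {x : ℝ | ∃ φ : GaugeConfig 3 L SU2 → ℝ, IsPhys φ ∧
        x = sSup (rayleighSet su2Rep L β fun ψ => P ψ ∧ l2 ψ φ = 0)} ≤
      sInf {x : ℝ | ∃ φ : GaugeConfig 3 L SU2 → ℝ, IsPhys φ ∧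
        x = sSup (rayleighSet su2Rep L β fun ψ => Q ψ ∧ l2 ψ φ = 0)} := by
  refine le_csInf (compressedSecondSet_nonempty β Q) ?_
  rintro x ⟨φ, hφ, rfl⟩
  exact (csInf_le (compressedSecondSet_bddBelow hβ P) ⟨φ, hφ, rfl⟩).trans
    (sSup_rayleighSet_mono hβ fun ψ hψ => ⟨h ψ hψ.1, hψ.2⟩)

/-- **`s_P ≤ t_P`**: the compressed second value is at most the compressed top value (constraint `φ = 1` in the infimum, then drop
the orthogonality condition). [cite: ReedSimonIV1978, Thm. XIII.1] -/
theorem compressedSecond_le_sSup_rayleighSet {β : ℝ} (hβ : 0 ≤ β) (P : (GaugeConfig 3 L SU2 → ℝ) → Prop) :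
    sInf {x : ℝ | ∃ φ : GaugeConfig 3 L SU2 → ℝ, IsPhys φ ∧
        x = sSup (rayleighSet su2Rep L β fun ψ => P ψ ∧ l2 ψ φ = 0)} ≤ sSup (rayleighSet su2Rep L β P) :=
  (csInf_le (compressedSecondSet_bddBelow hβ P) ⟨fun _ => 1, isPhys_const 1, rfl⟩).trans
    (sSup_rayleighSet_mono hβ fun _ hψ => hψ.1)

omit [NeZero L] in
/-- A larger wall set is a stronger support constraint: a test function vanishing at every configuration with a κ-bad plaquette in
`Q'` vanishes at every configuration with a κ-bad plaquette in `Q ⊆ Q'`. [folklore] -/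
theorem wall_mono (β κ : ℝ) {Q Q' : Set (Plaquette 3 L)} (hQ : Q ⊆ Q') (ψ : GaugeConfig 3 L SU2 → ℝ)
    (hψ : ∀ U : GaugeConfig 3 L SU2,
      (∃ p ∈ Q', β ^ (κ - 1) < 2 - (su2Rep (plaquetteHolonomy U p.1 p.2.1.1 p.2.1.2)).trace.re) → ψ U = 0) :
    ∀ U : GaugeConfig 3 L SU2,
      (∃ p ∈ Q, β ^ (κ - 1) < 2 - (su2Rep (plaquetteHolonomy U p.1 p.2.1.1 p.2.1.2)).trace.re) → ψ U = 0 :=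
  fun U ⟨p, hp, hlt⟩ => hψ U ⟨p, hQ hp, hlt⟩

/-- **The walled top value is antitone in the wall set** (`β ≥ 0`, any real `κ`, any lattice, no window). [folklore] -/
theorem walledTop_anti {β : ℝ} (hβ : 0 ≤ β) (κ : ℝ) {Q Q' : Set (Plaquette 3 L)} (hQ : Q ⊆ Q') :
    sSup (rayleighSet su2Rep L β fun ψ => ∀ U : GaugeConfig 3 L SU2,
        (∃ p ∈ Q', β ^ (κ - 1) < 2 - (su2Rep (plaquetteHolonomy U p.1 p.2.1.1 p.2.1.2)).trace.re) → ψ U = 0) ≤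
      sSup (rayleighSet su2Rep L β fun ψ => ∀ U : GaugeConfig 3 L SU2,
        (∃ p ∈ Q, β ^ (κ - 1) < 2 - (su2Rep (plaquetteHolonomy U p.1 p.2.1.1 p.2.1.2)).trace.re) → ψ U = 0) :=
  sSup_rayleighSet_mono hβ (wall_mono β κ hQ)

/-- **The walled first-excited (min–max) value is antitone in the wall set** (`β ≥ 0`, any real `κ`, any lattice, no window). [folklore] -/
theorem walledSecond_anti {β : ℝ} (hβ : 0 ≤ β) (κ : ℝ) {Q Q' : Set (Plaquette 3 L)} (hQ : Q ⊆ Q') :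
    sInf {x : ℝ | ∃ φ : GaugeConfig 3 L SU2 → ℝ, IsPhys φ ∧
        x = sSup (rayleighSet su2Rep L β fun ψ => (∀ U : GaugeConfig 3 L SU2,
          (∃ p ∈ Q', β ^ (κ - 1) < 2 - (su2Rep (plaquetteHolonomy U p.1 p.2.1.1 p.2.1.2)).trace.re) → ψ U = 0) ∧
          l2 ψ φ = 0)} ≤
      sInf {x : ℝ | ∃ φ : GaugeConfig 3 L SU2 → ℝ, IsPhys φ ∧
        x = sSup (rayleighSet su2Rep L β fun ψ => (∀ U : GaugeConfig 3 L SU2,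
          (∃ p ∈ Q, β ^ (κ - 1) < 2 - (su2Rep (plaquetteHolonomy U p.1 p.2.1.1 p.2.1.2)).trace.re) → ψ U = 0) ∧
          l2 ψ φ = 0)} :=
  compressedSecond_mono hβ (wall_mono β κ hQ)

/-! ## §2 Real-number endgame -/

/-- `(e^{a/L})^L = eᵃ` for `L ≠ 0`. [folklore] -/
theorem exp_div_pow_eq {a : ℝ} {L : ℕ} (hL : L ≠ 0) : Real.exp (a / L) ^ L = Real.exp a := by
  rw [← Real.exp_nat_mul]
  congr 1
  have hLr : (L : ℝ) ≠ 0 := Nat.cast_ne_zero.mpr hL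
  field_simp

/-- **Cross-multiplied endgame**: `0 ≤ x' ≤ x`, `0 ≤ y ≤ e^{a/L} y'` give `x'^L y^L ≤ eᵃ (x^L y'^L)`. [folklore] -/
theorem cross_pow_le_of_step {x x' y y' a : ℝ} {L : ℕ} (hL : L ≠ 0) (hx'0 : 0 ≤ x') (hx' : x' ≤ x)
    (hy0 : 0 ≤ y) (hy : y ≤ Real.exp (a / L) * y') :
    x' ^ L * y ^ L ≤ Real.exp a * (x ^ L * y' ^ L) := by
  have h1 : x' ^ L ≤ x ^ L := pow_le_pow_left₀ hx'0 hx' L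
  have h2 : y ^ L ≤ Real.exp a * y' ^ L := by
    calc y ^ L ≤ (Real.exp (a / L) * y') ^ L := pow_le_pow_left₀ hy0 hy L
      _ = Real.exp a * y' ^ L := by rw [mul_pow, exp_div_pow_eq hL]
  calc x' ^ L * y ^ L ≤ x ^ L * (Real.exp a * y' ^ L) :=
        mul_le_mul h1 h2 (pow_nonneg hy0 L) (le_trans (pow_nonneg hx'0 L) h1)
    _ = Real.exp a * (x ^ L * y' ^ L) := by ring

/-- **Cross-multiplied endgame, `L`-th power form**: `0 ≤ x' ≤ x`, `0 ≤ y`, `y^L ≤ eᵃ y'^L` (`y' ≥ 0`) give `x'^L y^L ≤ eᵃ (x^L y'^L)`.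
[folklore] -/
theorem cross_pow_le_of_pow {x x' y y' a : ℝ} {L : ℕ} (hx'0 : 0 ≤ x') (hx' : x' ≤ x)
    (hy0 : 0 ≤ y) (hy : y ^ L ≤ Real.exp a * y' ^ L) :
    x' ^ L * y ^ L ≤ Real.exp a * (x ^ L * y' ^ L) := by
  have h1 : x' ^ L ≤ x ^ L := pow_le_pow_left₀ hx'0 hx' L
  calc x' ^ L * y ^ L ≤ x ^ L * (Real.exp a * y' ^ L) :=
        mul_le_mul h1 hy (pow_nonneg hy0 L) (le_trans (pow_nonneg hx'0 L) h1)
    _ = Real.exp a * (x ^ L * y' ^ L) := by ring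

end Summit.QuantumFields.YangMills.Theorems.FemtoTransferGap.SFCompression

namespace Summit.QuantumFields.YangMills.Theorems.FemtoCutoffLadder

open Summit.QuantumFields.YangMills.Theorems.FemtoTransferGap
open Summit.QuantumFields.YangMills.Theses.FemtoCutoffLadder

/-! ## §3 ★ `LocalWallStep` from the two one-wall LOWER bounds -/

/-- ★ **`LocalWallStep` BY NAME from the two one-wall lower bounds** (per lattice time step): if deep in the femto window, for every
wall set `Q` and `p₀ ∉ Q`, `t Q ≤ e^{A/(β²N)/L} · t (Q ∪ {p₀})` and `s Q ≤ e^{A/(β²N)/L} · s (Q ∪ {p₀})` (`N = #Plaquette 3 L`), then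
`LocalWallStep` holds with the same `A, lam0, L0`: the opposite one-wall bounds `t (Q ∪ {p₀}) ≤ t Q`, `s (Q ∪ {p₀}) ≤ s Q` are free
(`walledTop_anti`, `walledSecond_anti`), positivity is `walledTop_pos`, and §2 cross-multiplies. [cite: ReedSimonIV1978, Thm. XIII.1] -/
theorem localWallStep_of_oneWallLowerBounds
    (h : ∀ κ : ℝ, 0 < κ → κ < 1 → ∃ (A lam0 : ℝ) (L0 : ℕ), 0 ≤ A ∧ 0 < lam0 ∧ ∀ lam : ℝ, 0 < lam → lam ≤ lam0 → ∀ (L : ℕ) [NeZero L], L0 ≤ L → ∀ β : ℝ, InFemtoWindow lam β L → let W : Set (Plaquette 3 L) → (GaugeConfig 3 L SU2 → ℝ) → Prop := fun Q ψ => ∀ U, (∃ p ∈ Q, β ^ (κ - 1) < 2 - (su2Rep (plaquetteHolonomy U p.1 p.2.1.1 p.2.1.2)).trace.re) → ψ U = 0; let t : Set (Plaquette 3 L) → ℝ := fun Q => sSup (rayleighSet su2Rep L β (W Q)); let s : Set (Plaquette 3 L) → ℝ := fun Q => sInf {x : ℝ | ∃ φ : GaugeConfig 3 L SU2 → ℝ,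 IsPhys φ ∧ x = sSup (rayleighSet su2Rep L β fun ψ => W Q ψ ∧ l2 ψ φ = 0)}; ∀ (Q : Set (Plaquette 3 L)) (p₀ : Plaquette 3 L), p₀ ∉ Q → t Q ≤ Real.exp (A / β ^ 2 / (Fintype.card (Plaquette 3 L) : ℝ) / L) * t (insert p₀ Q) ∧ s Q ≤ Real.exp (A / β ^ 2 / (Fintype.card (Plaquette 3 L) : ℝ) / L) * s (insert p₀ Q)) :
    LocalWallStep := by
  refine localWallStep_of_comparisons fun κ hκ hκ1 => ?_
  obtain ⟨A, lam0, L0, hA, hlam0, H⟩ := h κ hκ hκ1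
  refine ⟨A, lam0, L0, hA, hlam0, fun lam hlam hle L _ hL0 β hW => ?_⟩
  have hβ : 0 ≤ β := by linarith [hW.1]
  have hLne : L ≠ 0 := NeZero.ne L
  intro W t s Q p₀ hp₀
  obtain ⟨ht, hs⟩ := H lam hlam hle L hL0 β hW Q p₀ hp₀
  have hQ : Q ⊆ insert p₀ Q := Set.subset_insert p₀ Q
  -- the free (monotone) halves and the signs
  have ht' : t (insert p₀ Q) ≤ t Q := SFCompression.walledTop_anti hβ κ hQ
  have hs' : s (insert p₀ Q) ≤ s Q := SFCompression.walledSecond_anti hβ κ hQ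
  have ht0 : 0 ≤ t Q := SFCompression.sSup_rayleighSet_nonneg hβ _
  have ht'0 : 0 ≤ t (insert p₀ Q) := SFCompression.sSup_rayleighSet_nonneg hβ _
  have hs0 : 0 ≤ s Q := SFCompression.compressedSecond_nonneg hβ _
  have hs'0 : 0 ≤ s (insert p₀ Q) := SFCompression.compressedSecond_nonneg hβ _
  refine ⟨SFCompression.cross_pow_le_of_step hLne hs'0 hs' ht0 ht, ?_⟩
  have := SFCompression.cross_pow_le_of_step hLne ht'0 ht' hs0 hs
  -- `t'^L s^L ≤ eᵃ (t^L s'^L)`, reorder the products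
  calc s Q ^ L * t (insert p₀ Q) ^ L = t (insert p₀ Q) ^ L * s Q ^ L := mul_comm _ _
    _ ≤ Real.exp (A / β ^ 2 / (Fintype.card (Plaquette 3 L) : ℝ)) * (t Q ^ L * s (insert p₀ Q) ^ L) := this
    _ = Real.exp (A / β ^ 2 / (Fintype.card (Plaquette 3 L) : ℝ)) * (s (insert p₀ Q) ^ L * t Q ^ L) := by
        rw [mul_comm (t Q ^ L)]

/-- ★ **`LocalWallStep` BY NAME from the two one-wall lower bounds in `L`-th-power form**: `t Q ^ L ≤ e^{A/(β²N)} · t (Q ∪ {p₀}) ^ L`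
and `s Q ^ L ≤ e^{A/(β²N)} · s (Q ∪ {p₀}) ^ L` for every wall set `Q` and `p₀ ∉ Q`, deep in the femto window, give `LocalWallStep` with the
same constants. [cite: ReedSimonIV1978, Thm. XIII.1] -/
theorem localWallStep_of_oneWallPowLowerBounds
    (h : ∀ κ : ℝ, 0 < κ → κ < 1 → ∃ (A lam0 : ℝ) (L0 : ℕ), 0 ≤ A ∧ 0 < lam0 ∧ ∀ lam : ℝ, 0 < lam → lam ≤ lam0 → ∀ (L : ℕ) [NeZero L], L0 ≤ L → ∀ β : ℝ, InFemtoWindow lam β L → let W : Set (Plaquette 3 L) → (GaugeConfig 3 L SU2 → ℝ) → Prop := fun Q ψ => ∀ U, (∃ p ∈ Q, β ^ (κ - 1) < 2 - (su2Rep (plaquetteHolonomy U p.1 p.2.1.1 p.2.1.2)).trace.re) → ψ U = 0; let t : Set (Plaquette 3 L) → ℝ := fun Q => sSup (rayleighSet su2Rep L β (W Q)); let s : Set (Plaquette 3 L) → ℝ := fun Q => sInf {x : ℝ | ∃ φ : GaugeConfig 3 L SU2 → ℝ, IsPhys φ ∧ x = sSup (rayleighSet su2Rep L β fun ψ => W Q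 ψ ∧ l2 ψ φ = 0)}; ∀ (Q : Set (Plaquette 3 L)) (p₀ : Plaquette 3 L), p₀ ∉ Q → t Q ^ L ≤ Real.exp (A / β ^ 2 / (Fintype.card (Plaquette 3 L) : ℝ)) * t (insert p₀ Q) ^ L ∧ s Q ^ L ≤ Real.exp (A / β ^ 2 / (Fintype.card (Plaquette 3 L) : ℝ)) * s (insert p₀ Q) ^ L) :
    LocalWallStep := by
  refine localWallStep_of_comparisons fun κ hκ hκ1 => ?_
  obtain ⟨A, lam0, L0, hA, hlam0, H⟩ := h κ hκ hκ1
  refine ⟨A, lam0, L0, hA, hlam0, fun lam hlam hle L _ hL0 β hW => ?_⟩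
  have hβ : 0 ≤ β := by linarith [hW.1]
  intro W t s Q p₀ hp₀
  obtain ⟨ht, hs⟩ := H lam hlam hle L hL0 β hW Q p₀ hp₀
  have hQ : Q ⊆ insert p₀ Q := Set.subset_insert p₀ Q
  have ht' : t (insert p₀ Q) ≤ t Q := SFCompression.walledTop_anti hβ κ hQ
  have hs' : s (insert p₀ Q) ≤ s Q := SFCompression.walledSecond_anti hβ κ hQ
  have ht0 : 0 ≤ t Q := SFCompression.sSup_rayleighSet_nonneg hβ _
  have ht'0 : 0 ≤ t (insert p₀ Q) := SFCompression.sSup_rayleighSet_nonneg hβ _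
  have hs0 : 0 ≤ s Q := SFCompression.compressedSecond_nonneg hβ _
  have hs'0 : 0 ≤ s (insert p₀ Q) := SFCompression.compressedSecond_nonneg hβ _
  refine ⟨SFCompression.cross_pow_le_of_pow hs'0 hs' ht0 ht, ?_⟩
  have := SFCompression.cross_pow_le_of_pow ht'0 ht' hs0 hs
  calc s Q ^ L * t (insert p₀ Q) ^ L = t (insert p₀ Q) ^ L * s Q ^ L := mul_comm _ _
    _ ≤ Real.exp (A / β ^ 2 / (Fintype.card (Plaquette 3 L) : ℝ)) * (t Q ^ L * s (insert p₀ Q) ^ L) := this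
    _ = Real.exp (A / β ^ 2 / (Fintype.card (Plaquette 3 L) : ℝ)) * (s (insert p₀ Q) ^ L * t Q ^ L) := by
        rw [mul_comm (t Q ^ L)]

end Summit.QuantumFields.YangMills.Theorems.FemtoCutoffLadder

end
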